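import Summits.Ventures.Crystal3D.Bulk.CapBoxSprocZ
import HarnessLib

/-!
# Tensor-Bernstein branch and bound on RECTANGULAR tensors (per-axis degrees `n₀, n₁, n₂`)

Venture `Crystal3D` (cell `pub-crystal3d`, phase 2; seat typer-bulk). The searches of `CapBoxSearch.lean` /
`CapBoxSproc.lean` / `CapBoxSprocZ.lean` carry ONE degree `n` on all three axes, so a target of per-axis degrees
`(16, 16, 32)` (the X2 pair polynomials: `u`- and `v`-degree `d_X`, `t`-degree `2 d_X`) is padded to the cube
`33³` — `3.8×` the entries and `≈ 10×` the de Casteljau work of the honest `17 × 17 × 33` tensor. This file is the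
rectangular layer: shapes `Shape3R n₀ n₁ n₂`, values `val3NR` / `val3QR` (Bernstein degree `nᵢ` on axis `i`), the
shape and value lemmas of the three splits (a split along axis `i` scales by `2^{nᵢ}`), and the sign enclosures.
The search, the S-procedure bridge and the end-to-end check are in `CapBoxRectCheck.lean`.
Everything is structurally recursive. HONEST FRAMING: bookkeeping [folklore: tensor Bernstein enclosure, de
Casteljau subdivision]; nothing geometric is proved here.
-/

open Finset

namespace Summit.Ventures.Crystal3D.CapCut.Bern

/-! ### Rectangular shapes and values -/

/-- Shape `(n₀+1) × (n₁+1) × (n₂+1)` (`Prop` form). [folklore] -/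
def Shape3R {β : Type} (n0 n1 n2 : ℕ) (Z : List (List (List β))) : Prop :=
  Z.length = n0 + 1 ∧ ∀ sl ∈ Z, sl.length = n1 + 1 ∧ ∀ ln ∈ sl, ln.length = n2 + 1

/-- Shape test (Boolean). [folklore] -/
def shapeOK3R {β : Type} (n0 n1 n2 : ℕ) (Z : List (List (List β))) : Bool :=
  Z.length == n0 + 1 && Z.all fun sl => sl.length == n1 + 1 && sl.all fun ln => ln.length == n2 + 1

/-- The Boolean shape test is correct. [folklore] -/
theorem shape3R_of_shapeOK3R {β : Type} (n0 n1 n2 : ℕ) (Z : List (List (List β)))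
    (h : shapeOK3R n0 n1 n2 Z = true) : Shape3R n0 n1 n2 Z := by
  simp only [shapeOK3R, Bool.and_eq_true, beq_iff_eq, List.all_eq_true] at h
  exact ⟨h.1, fun sl hsl => ⟨(h.2 sl hsl).1, fun ln hln => (h.2 sl hsl).2 ln hln⟩⟩

/-- Bernstein-form value of a natural-number tensor, degree `nᵢ` on axis `i`. [folklore] -/
def val3NR (n0 n1 n2 : ℕ) (Z : T3) (s1 s2 s3 : ℝ) : ℝ :=
  bvF (fun sl => bvF (fun ln => bvF (fun x : ℕ => (x : ℝ)) 0 n2 ln s3) [] n1 sl s2) [] n0 Z s1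

/-- Bernstein-form value of a rational tensor, degree `nᵢ` on axis `i`. [folklore] -/
def val3QR (n0 n1 n2 : ℕ) (B : QT3) (s1 s2 s3 : ℝ) : ℝ :=
  bvF (fun sl => bvF (fun ln => bvF (fun q : ℚ => (q : ℝ)) 0 n2 ln s3) [] n1 sl s2) [] n0 B s1

/-- Level 2 with two degrees (slices of naturals). [folklore] -/
theorem lin2R (n1 n2 : ℕ) (s2 s3 : ℝ) :
    IsLin2 (fun sl : T2 => bvF (fun ln : T1 => bvF (fun x : ℕ => (x : ℝ)) 0 n2 ln s3) [] n1 sl s2) [] add2 sc2 where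
  zero := by simp [bvF]
  add := fun x y => bvF_lzip (F := fun ln : T1 => bvF (fun w : ℕ => (w : ℝ)) 0 n2 ln s3) (z := []) (add := add1)
    (lin1 n2 s3).zero (lin1 n2 s3).add n1 s2 x y
  sc := fun e x => bvF_map (F := fun ln : T1 => bvF (fun w : ℕ => (w : ℝ)) 0 n2 ln s3) (z := [])
    (F' := fun ln : T1 => bvF (fun w : ℕ => (w : ℝ)) 0 n2 ln s3) (z' := []) (sc1 e) (2 ^ e) rfl
    (fun w => (lin1 n2 s3).sc e w) n1 s2 x

/-- Level 2 with two degrees (rational slices). [folklore] -/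
theorem linQ2R (n1 n2 : ℕ) (s2 s3 : ℝ) :
    IsLin (fun sl : QT2 => bvF (fun ln : QT1 => bvF (fun q : ℚ => (q : ℝ)) 0 n2 ln s3) [] n1 sl s2) [] qadd2 qsmul2 where
  zero := by simp [bvF]
  add := fun x y => bvF_lzip (F := fun ln : QT1 => bvF (fun q : ℚ => (q : ℝ)) 0 n2 ln s3) (z := []) (add := qadd1)
    (linQ1 n2 s3).zero (linQ1 n2 s3).add n1 s2 x y
  smul := fun c x => bvF_map (F := fun ln : QT1 => bvF (fun q : ℚ => (q : ℝ)) 0 n2 ln s3) (z := [])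
    (F' := fun ln : QT1 => bvF (fun q : ℚ => (q : ℝ)) 0 n2 ln s3) (z' := []) (qsmul1 c) (c : ℝ) rfl
    (fun w => (linQ1 n2 s3).smul c w) n1 s2 x

/-! ### Shapes are preserved by the splits -/

section Shapes

/-- Slice predicate with two degrees. [folklore] -/
def P2R (n1 n2 : ℕ) (sl : T2) : Prop := sl.length = n1 + 1 ∧ ∀ ln ∈ sl, P1 n2 ln

/-- `add2` preserves the slice shape. [folklore] -/
theorem add2_P2R (n1 n2 : ℕ) (a b : T2) (ha : P2R n1 n2 a) (hb : P2R n1 n2 b) : P2R n1 n2 (add2 a b) :=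
  ⟨lzip_length _ a b _ ha.1 hb.1, lzip_forall add1 (P1 n2) (add1_P1 n2) a b ha.2 hb.2⟩

/-- `sc2` preserves the slice shape. [folklore] -/
theorem sc2_P2R (n1 n2 e : ℕ) (a : T2) (ha : P2R n1 n2 a) : P2R n1 n2 (sc2 e a) := by
  refine ⟨by unfold sc2; rw [List.length_map, ha.1], fun ln hln => ?_⟩
  unfold sc2 at hln
  rw [List.mem_map] at hln
  obtain ⟨ln', hln', rfl⟩ := hln
  exact sc1_P1 n2 e ln' (ha.2 ln' hln')

/-- `Shape3R` in terms of `P2R`. [folklore] -/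
theorem shape3R_iff (n0 n1 n2 : ℕ) (Z : T3) :
    Shape3R n0 n1 n2 Z ↔ Z.length = n0 + 1 ∧ ∀ sl ∈ Z, P2R n1 n2 sl := Iff.rfl

/-- The left child has the parent's shape. [folklore] -/
theorem shape3R_splitL (n0 n1 n2 ax : ℕ) (Z : T3) (hZ : Shape3R n0 n1 n2 Z) :
    Shape3R n0 n1 n2 (splitL ax Z) := by
  rw [shape3R_iff] at hZ ⊢
  match ax with
  | 0 =>
    exact ⟨by simp only [splitL]; rw [castL_length, hZ.1],
      castL_forall add2 sc2 (P2R n1 n2) (add2_P2R n1 n2) (sc2_P2R n1 n2) Z hZ.2⟩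
  | 1 =>
    refine ⟨by simp only [splitL, List.length_map, hZ.1], fun sl hsl => ?_⟩
    simp only [splitL, List.mem_map] at hsl
    obtain ⟨sl', hsl', rfl⟩ := hsl
    exact ⟨by rw [castL_length]; exact (hZ.2 sl' hsl').1,
      castL_forall add1 sc1 (P1 n2) (add1_P1 n2) (sc1_P1 n2) sl' (hZ.2 sl' hsl').2⟩
  | k + 2 =>
    refine ⟨by simp only [splitL, List.length_map, hZ.1], fun sl hsl => ?_⟩
    simp only [splitL, List.mem_map] at hsl
    obtain ⟨sl', hsl', rfl⟩ := hsl
    refine ⟨by rw [List.length_map]; exact (hZ.2 sl' hsl').1, fun ln hln => ?_⟩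
    rw [List.mem_map] at hln
    obtain ⟨ln', hln', rfl⟩ := hln
    unfold P1; rw [castL_length]; exact (hZ.2 sl' hsl').2 ln' hln'

/-- The right child has the parent's shape. [folklore] -/
theorem shape3R_splitR (n0 n1 n2 ax : ℕ) (Z : T3) (hZ : Shape3R n0 n1 n2 Z) :
    Shape3R n0 n1 n2 (splitR ax Z) := by
  rw [shape3R_iff] at hZ ⊢
  match ax with
  | 0 =>
    exact ⟨by simp only [splitR]; rw [castR_length, hZ.1],
      castR_forall add2 sc2 (P2R n1 n2) (add2_P2R n1 n2) (sc2_P2R n1 n2) Z hZ.2⟩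
  | 1 =>
    refine ⟨by simp only [splitR, List.length_map, hZ.1], fun sl hsl => ?_⟩
    simp only [splitR, List.mem_map] at hsl
    obtain ⟨sl', hsl', rfl⟩ := hsl
    exact ⟨by rw [castR_length]; exact (hZ.2 sl' hsl').1,
      castR_forall add1 sc1 (P1 n2) (add1_P1 n2) (sc1_P1 n2) sl' (hZ.2 sl' hsl').2⟩
  | k + 2 =>
    refine ⟨by simp only [splitR, List.length_map, hZ.1], fun sl hsl => ?_⟩
    simp only [splitR, List.mem_map] at hsl
    obtain ⟨sl', hsl', rfl⟩ := hsl
    refine ⟨by rw [List.length_map]; exact (hZ.2 sl' hsl').1, fun ln hln => ?_⟩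
    rw [List.mem_map] at hln
    obtain ⟨ln', hln', rfl⟩ := hln
    unfold P1; rw [castR_length]; exact (hZ.2 sl' hsl').2 ln' hln'

end Shapes

/-! ### Values of the children -/

section Split
variable (n0 n1 n2 : ℕ)

/-- Axis `u`, left: `val3 (splitL 0 Z) (2s₁) = 2^{n₀} val3 Z s₁`. [folklore] -/
theorem val3NR_splitL0 (Z : T3) (hZ : Shape3R n0 n1 n2 Z) (s1 s2 s3 : ℝ) :
    val3NR n0 n1 n2 (splitL 0 Z) (2 * s1) s2 s3 = 2 ^ n0 * val3NR n0 n1 n2 Z s1 s2 s3 := by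
  unfold val3NR; simp only [splitL]
  rw [bvF_castL (lin2R n1 n2 s2 s3) n0 Z hZ.1]; congr 2; ring

/-- Axis `u`, right: `val3 (splitR 0 Z) (2s₁ - 1) = 2^{n₀} val3 Z s₁`. [folklore] -/
theorem val3NR_splitR0 (Z : T3) (hZ : Shape3R n0 n1 n2 Z) (s1 s2 s3 : ℝ) :
    val3NR n0 n1 n2 (splitR 0 Z) (2 * s1 - 1) s2 s3 = 2 ^ n0 * val3NR n0 n1 n2 Z s1 s2 s3 := by
  unfold val3NR; simp only [splitR]
  rw [bvF_castR (lin2R n1 n2 s2 s3) n0 Z hZ.1]; congr 2; ring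

/-- Axis `v`, left (factor `2^{n₁}`). [folklore] -/
theorem val3NR_splitL1 (Z : T3) (hZ : Shape3R n0 n1 n2 Z) (s1 s2 s3 : ℝ) :
    val3NR n0 n1 n2 (splitL 1 Z) s1 (2 * s2) s3 = 2 ^ n1 * val3NR n0 n1 n2 Z s1 s2 s3 := by
  unfold val3NR; simp only [splitL]
  rw [bvF_map_mem (F := (fun sl : T2 => bvF (fun ln : T1 => bvF (fun w : ℕ => (w : ℝ)) 0 n2 ln s3) [] n1 sl (2 * s2)))
    (z := []) (F' := (fun sl : T2 => bvF (fun ln : T1 => bvF (fun w : ℕ => (w : ℝ)) 0 n2 ln s3) [] n1 sl s2)) (z' := [])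
    (castL add1 sc1) (2 ^ n1) (by simp [bvF]) (by simp [bvF]) n0 s1 Z]
  intro sl hsl
  show bvF _ [] n1 (castL add1 sc1 sl) (2 * s2) = _
  rw [bvF_castL (lin1 n2 s3) n1 sl (hZ.2 sl hsl).1]; congr 2; ring

/-- Axis `v`, right (factor `2^{n₁}`). [folklore] -/
theorem val3NR_splitR1 (Z : T3) (hZ : Shape3R n0 n1 n2 Z) (s1 s2 s3 : ℝ) :
    val3NR n0 n1 n2 (splitR 1 Z) s1 (2 * s2 - 1) s3 = 2 ^ n1 * val3NR n0 n1 n2 Z s1 s2 s3 := by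
  unfold val3NR; simp only [splitR]
  rw [bvF_map_mem (F := (fun sl : T2 => bvF (fun ln : T1 => bvF (fun w : ℕ => (w : ℝ)) 0 n2 ln s3) [] n1 sl (2 * s2 - 1)))
    (z := []) (F' := (fun sl : T2 => bvF (fun ln : T1 => bvF (fun w : ℕ => (w : ℝ)) 0 n2 ln s3) [] n1 sl s2)) (z' := [])
    (castR add1 sc1) (2 ^ n1) (by simp [bvF]) (by simp [bvF]) n0 s1 Z]
  intro sl hsl
  show bvF _ [] n1 (castR add1 sc1 sl) (2 * s2 - 1) = _
  rw [bvF_castR (lin1 n2 s3) n1 sl (hZ.2 sl hsl).1]; congr 2; ring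

/-- Axis `t`, left (factor `2^{n₂}`). [folklore] -/
theorem val3NR_splitL2 (k : ℕ) (Z : T3) (hZ : Shape3R n0 n1 n2 Z) (s1 s2 s3 : ℝ) :
    val3NR n0 n1 n2 (splitL (k + 2) Z) s1 s2 (2 * s3) = 2 ^ n2 * val3NR n0 n1 n2 Z s1 s2 s3 := by
  unfold val3NR; simp only [splitL]
  rw [bvF_map_mem (F := (fun sl : T2 => bvF (fun ln : T1 => bvF (fun w : ℕ => (w : ℝ)) 0 n2 ln (2 * s3)) [] n1 sl s2))
    (z := []) (F' := (fun sl : T2 => bvF (fun ln : T1 => bvF (fun w : ℕ => (w : ℝ)) 0 n2 ln s3) [] n1 sl s2)) (z' := [])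
    (List.map (castL Nat.add sc0)) (2 ^ n2) (by simp [bvF]) (by simp [bvF]) n0 s1 Z]
  intro sl hsl
  show bvF _ [] n1 (sl.map (castL Nat.add sc0)) s2 = _
  rw [bvF_map_mem (F := fun ln : T1 => bvF (fun w : ℕ => (w : ℝ)) 0 n2 ln (2 * s3)) (z := [])
    (F' := fun ln : T1 => bvF (fun w : ℕ => (w : ℝ)) 0 n2 ln s3) (z' := []) (castL Nat.add sc0) (2 ^ n2)
    (by simp [bvF]) (by simp [bvF]) n1 s2 sl]
  intro ln hln
  show bvF _ 0 n2 (castL Nat.add sc0 ln) (2 * s3) = _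
  rw [bvF_castL lin0 n2 ln ((hZ.2 sl hsl).2 ln hln)]; congr 2; ring

/-- Axis `t`, right (factor `2^{n₂}`). [folklore] -/
theorem val3NR_splitR2 (k : ℕ) (Z : T3) (hZ : Shape3R n0 n1 n2 Z) (s1 s2 s3 : ℝ) :
    val3NR n0 n1 n2 (splitR (k + 2) Z) s1 s2 (2 * s3 - 1) = 2 ^ n2 * val3NR n0 n1 n2 Z s1 s2 s3 := by
  unfold val3NR; simp only [splitR]
  rw [bvF_map_mem (F := (fun sl : T2 => bvF (fun ln : T1 => bvF (fun w : ℕ => (w : ℝ)) 0 n2 ln (2 * s3 - 1)) [] n1 sl s2))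
    (z := []) (F' := (fun sl : T2 => bvF (fun ln : T1 => bvF (fun w : ℕ => (w : ℝ)) 0 n2 ln s3) [] n1 sl s2)) (z' := [])
    (List.map (castR Nat.add sc0)) (2 ^ n2) (by simp [bvF]) (by simp [bvF]) n0 s1 Z]
  intro sl hsl
  show bvF _ [] n1 (sl.map (castR Nat.add sc0)) s2 = _
  rw [bvF_map_mem (F := fun ln : T1 => bvF (fun w : ℕ => (w : ℝ)) 0 n2 ln (2 * s3 - 1)) (z := [])
    (F' := fun ln : T1 => bvF (fun w : ℕ => (w : ℝ)) 0 n2 ln s3) (z' := []) (castR Nat.add sc0) (2 ^ n2)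
    (by simp [bvF]) (by simp [bvF]) n1 s2 sl]
  intro ln hln
  show bvF _ 0 n2 (castR Nat.add sc0 ln) (2 * s3 - 1) = _
  rw [bvF_castR lin0 n2 ln ((hZ.2 sl hsl).2 ln hln)]; congr 2; ring

end Split

/-! ### Sign tests -/

/-- All entries `≥ θ` ⇒ value `≥ θ` on the cube. [folklore] -/
theorem le_val3NR_of_allGe3 (n0 n1 n2 : ℕ) (Z : T3) (hZ : Shape3R n0 n1 n2 Z) (θ : ℕ) (h : allGe3 θ Z = true)
    {s1 s2 s3 : ℝ} (h10 : 0 ≤ s1) (h11 : s1 ≤ 1) (h20 : 0 ≤ s2) (h21 : s2 ≤ 1) (h30 : 0 ≤ s3) (h31 : s3 ≤ 1) :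
    (θ : ℝ) ≤ val3NR n0 n1 n2 Z s1 s2 s3 := by
  simp only [allGe3, List.all_eq_true, Nat.ble_eq] at h
  unfold val3NR
  refine le_bvF_of_forall n0 Z (θ : ℝ) (fun a ha => ?_) h10 h11
  have hsl := getD_mem_of_lt Z [] (by rw [hZ.1]; omega : a < Z.length)
  refine le_bvF_of_forall n1 _ (θ : ℝ) (fun b hb => ?_) h20 h21
  have hln := getD_mem_of_lt (Z.getD a []) [] (by rw [(hZ.2 _ hsl).1]; omega : b < (Z.getD a []).length)
  refine le_bvF_of_forall n2 _ (θ : ℝ) (fun c hc => ?_) h30 h31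
  have hx := getD_mem_of_lt ((Z.getD a []).getD b []) 0
    (by rw [(hZ.2 _ hsl).2 _ hln]; omega : c < ((Z.getD a []).getD b []).length)
  exact_mod_cast h _ hsl _ hln _ hx

/-- All entries `< η` ⇒ value `< η` on the cube. [folklore] -/
theorem val3NR_lt_of_allLt3 (n0 n1 n2 : ℕ) (Z : T3) (hZ : Shape3R n0 n1 n2 Z) (η : ℕ) (h : allLt3 η Z = true)
    {s1 s2 s3 : ℝ} (h10 : 0 ≤ s1) (h11 : s1 ≤ 1) (h20 : 0 ≤ s2) (h21 : s2 ≤ 1) (h30 : 0 ≤ s3) (h31 : s3 ≤ 1) :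
    val3NR n0 n1 n2 Z s1 s2 s3 < η := by
  simp only [allLt3, List.all_eq_true, Nat.blt_eq] at h
  have hmain : val3NR n0 n1 n2 Z s1 s2 s3 ≤ (η : ℝ) - 1 := by
    unfold val3NR
    refine bvF_le_of_forall n0 Z ((η : ℝ) - 1) (fun a ha => ?_) h10 h11
    have hsl := getD_mem_of_lt Z [] (by rw [hZ.1]; omega : a < Z.length)
    refine bvF_le_of_forall n1 _ ((η : ℝ) - 1) (fun b hb => ?_) h20 h21
    have hln := getD_mem_of_lt (Z.getD a []) [] (by rw [(hZ.2 _ hsl).1]; omega : b < (Z.getD a []).length)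
    refine bvF_le_of_forall n2 _ ((η : ℝ) - 1) (fun c hc => ?_) h30 h31
    have hx := getD_mem_of_lt ((Z.getD a []).getD b []) 0
      (by rw [(hZ.2 _ hsl).2 _ hln]; omega : c < ((Z.getD a []).getD b []).length)
    have hlt := h _ hsl _ hln _ hx
    have : (((Z.getD a []).getD b []).getD c 0 : ℝ) + 1 ≤ η := by exact_mod_cast hlt
    linarith
  linarith

/-! ### The S-procedure combination on rectangular tensors -/

/-- The combination tensor's value (rectangular shape). [folklore] -/
theorem val3QR_sprocW (n0 n1 n2 : ℕ) (σ : ℚ) (θ η : ℕ) (Y H : T3) (hY : Shape3R n0 n1 n2 Y)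
    (hH : Shape3R n0 n1 n2 H) (s1 s2 s3 : ℝ) :
    val3QR n0 n1 n2 (sprocW σ θ η Y H) s1 s2 s3 =
      (val3NR n0 n1 n2 Y s1 s2 s3 - θ) - (σ : ℝ) * (val3NR n0 n1 n2 H s1 s2 s3 - η) := by
  unfold val3QR val3NR sprocW
  refine bvF_zipWith_affine _ (σ : ℝ) (θ : ℝ) (η : ℝ) n0 Y H hY.1 hH.1 s1 fun sl hsl hl hhl => ?_
  refine bvF_zipWith_affine _ (σ : ℝ) (θ : ℝ) (η : ℝ) n1 sl hl (hY.2 sl hsl).1 (hH.2 hl hhl).1 s2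
    fun ln hln hn hhn => ?_
  refine bvF_zipWith_affine _ (σ : ℝ) (θ : ℝ) (η : ℝ) n2 ln hn ((hY.2 sl hsl).2 ln hln) ((hH.2 hl hhl).2 hn hhn) s3
    fun y _ h _ => ?_
  push_cast; ring

/-- Shape of the combination tensor (rectangular). [folklore] -/
theorem shape3R_sprocW (n0 n1 n2 : ℕ) (σ : ℚ) (θ η : ℕ) (Y H : T3) (hY : Shape3R n0 n1 n2 Y)
    (hH : Shape3R n0 n1 n2 H) : Shape3R n0 n1 n2 (sprocW σ θ η Y H) := by
  unfold sprocW
  refine ⟨length_zipWith_eq _ Y H hY.1 hH.1, ?_⟩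
  refine forall_mem_zipWith _ _ Y H fun a ha b hb => ?_
  refine ⟨length_zipWith_eq _ a b (hY.2 a ha).1 (hH.2 b hb).1, ?_⟩
  refine forall_mem_zipWith _ _ a b fun x hx y hy => ?_
  exact length_zipWith_eq _ x y ((hY.2 a ha).2 x hx) ((hH.2 b hb).2 y hy)

/-- All entries `≥ 0` ⇒ Bernstein value `≥ 0` on the cube (rational, rectangular). [folklore] -/
theorem val3QR_nonneg_of_allNonneg3 (n0 n1 n2 : ℕ) (W : QT3) (hW : Shape3R n0 n1 n2 W) (h : allNonneg3 W = true)
    {s1 s2 s3 : ℝ} (h10 : 0 ≤ s1) (h11 : s1 ≤ 1) (h20 : 0 ≤ s2) (h21 : s2 ≤ 1) (h30 : 0 ≤ s3) (h31 : s3 ≤ 1) :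
    0 ≤ val3QR n0 n1 n2 W s1 s2 s3 := by
  simp only [allNonneg3, List.all_eq_true, decide_eq_true_eq] at h
  unfold val3QR
  refine le_bvF_of_forall n0 W 0 (fun a ha => ?_) h10 h11
  have hsl := getD_mem_of_lt W [] (by rw [hW.1]; omega : a < W.length)
  refine le_bvF_of_forall n1 _ 0 (fun b hb => ?_) h20 h21
  have hln := getD_mem_of_lt (W.getD a []) [] (by rw [(hW.2 _ hsl).1]; omega : b < (W.getD a []).length)
  refine le_bvF_of_forall n2 _ 0 (fun c hc => ?_) h30 h31
  have hx := getD_mem_of_lt ((W.getD a []).getD b []) 0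
    (by rw [(hW.2 _ hsl).2 _ hln]; omega : c < ((W.getD a []).getD b []).length)
  exact_mod_cast h _ hsl _ hln _ hx

/-- **Soundness of the integer S-procedure box rule (rectangular)**. [folklore] -/
theorem le_val3NR_of_accZ (n0 n1 n2 θ η p : ℕ) (Y H : T3) (hY : Shape3R n0 n1 n2 Y) (hH : Shape3R n0 n1 n2 H)
    (h : accZ p θ η Y H = true) {s1 s2 s3 : ℝ} (h10 : 0 ≤ s1) (h11 : s1 ≤ 1) (h20 : 0 ≤ s2) (h21 : s2 ≤ 1)
    (h30 : 0 ≤ s3) (h31 : s3 ≤ 1) (hval : (η : ℝ) ≤ val3NR n0 n1 n2 H s1 s2 s3) :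
    (θ : ℝ) ≤ val3NR n0 n1 n2 Y s1 s2 s3 := by
  have hσ0 : (0 : ℝ) ≤ ((((p : ℚ) / 2 ^ 64 : ℚ)) : ℝ) := by
    have : (0 : ℚ) ≤ (p : ℚ) / 2 ^ 64 := by positivity
    exact_mod_cast this
  have hW := val3QR_nonneg_of_allNonneg3 n0 n1 n2 _ (shape3R_sprocW n0 n1 n2 ((p : ℚ) / 2 ^ 64) θ η Y H hY hH)
    (allNonneg3_sprocW_of_accZ p θ η Y H h) h10 h11 h20 h21 h30 h31
  rw [val3QR_sprocW n0 n1 n2 ((p : ℚ) / 2 ^ 64) θ η Y H hY hH] at hW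
  have : (0 : ℝ) ≤ ((((p : ℚ) / 2 ^ 64 : ℚ)) : ℝ) * (val3NR n0 n1 n2 H s1 s2 s3 - η) :=
    mul_nonneg hσ0 (by linarith)
  linarith

end Summit.Ventures.Crystal3D.CapCut.Bern
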